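import Summits.Langlands.Langlands.Theorems.PhantomRMYoshidaResiduallyYoshidaLiftingCrossRegularDefs
import Literature.NumberTheory.GaloisRepresentations.ResidualPairIntegrality
import Literature.NumberTheory.Automorphic.AutomorphicRepsGLSatakeFlathProofs
import HarnessLib

/-!
# Route `PhantomRMYoshida`, crux `ResiduallyYoshidaLifting` (stmt-Langlands-13639), line
# `cross-regular-annihilator-primes`: S5c `stub_traceCatalogue` from the purely automorphic finiteness bridge

`frobCatalogue_of_finiteCuspidal`: the hypothesis `H_frob` of the landed
`stub_traceCatalogue_of_frobCatalogue` (p99281) follows from the MISSING BRIDGE `H_fin` — finiteness, up to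
near equivalence, of the cuspidal `π` on `GL₄(𝔸_ℚ)` with a `K(𝔫₁)`-fixed vector in `W ∖ W'` and
infinity type `T₁` — using only uniqueness of Satake parameters (`hasSatakeParamAt_unique_holds`,
proved) and uniqueness of Frobenius polynomials.  Together with p99281 this makes the registered S5c CLOSED MODULO `H_fin`, the finiteness (up to near
equivalence) of the cuspidal automorphic representations of `GL₄(𝔸_ℚ)` of fixed principal-congruence level and
infinity type — Harish-Chandra finiteness in representation form (Borel–Jacquet 1979, 4.3 (i)); the tree proves
the automorphic-FORMS version `harishChandra_finiteness_gl_holds`, and the lead's census names the missing bridge.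
Nothing is asserted: `H_fin` is a hypothesis. [cite: BorelJacquet1979, 4.3 (i)]
-/

noncomputable section

set_option linter.dupNamespace false

open Field IsDedekindDomain Filter Topology
open scoped NumberField Valued Classical

namespace Summit.Langlands.Langlands.Cruxes.ResiduallyYoshidaLifting.CrossRegularAnnihilatorPrimes

open Literature.NumberTheory.GaloisRepresentations Literature.NumberTheory.Automorphic

/-- The Frobenius-a.e. catalogue `H_frob` of `stub_traceCatalogue_of_frobCatalogue` from the automorphic
finiteness bridge `H_fin` (hypothesis after `𝔫₁ ≠ 0`): pick one member in every near-equivalence class met by a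
member; two members with nearly equivalent `π` have the same Satake parameters a.e.
(`hasSatakeParamAt_unique_holds`), hence the same Frobenius polynomials a.e.  So S5c = `H_fin` + p99281.
[cite: BorelJacquet1979, 4.3 (i) (the finiteness input isolated as `H_fin`)] -/
theorem frobCatalogue_of_finiteCuspidal : ∀ (p : ℕ) [Fact p.Prime], p ≠ 2 → ∀ (k : Type) [Field k] [CharP k p] [IsAlgClosed k] [TopologicalSpace k] [DiscreteTopology k] (red : Valued.integer (PadicAlgCl p) →+* k) (σ σ' : Literature.NumberTheory.GaloisRepresentations.FramedGaloisRep ℚ k 2) (hcpt : Literature.NumberTheory.Automorphic.isCompact_glFiniteIntegralLevel 4 ℚ) (ι : PadicAlgCl p ≃+* ℂ) (𝔫₁ : Ideal (NumberField.RingOfIntegers ℚ)) (T₁ : Literature.NumberTheory.Automorphic.InfinityType ℚ 4), 𝔫₁ ≠ 0 →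
    (∃ (s : ℕ) (πc : Fin s → Literature.NumberTheory.Automorphic.CuspidalAutomorphicRepData 4 ℚ hcpt), ∀ π : Literature.NumberTheory.Automorphic.CuspidalAutomorphicRepData 4 ℚ hcpt, π.1.HasInfinityType T₁ → (∃ φ ∈ π.1.W, φ ∉ π.1.W' ∧ ∀ u ∈ Literature.NumberTheory.Automorphic.principalCongruenceLevel 4 ℚ 𝔫₁, Literature.NumberTheory.Automorphic.rightTranslation (Literature.NumberTheory.Automorphic.AdelicGroupData.gl 4 ℚ) u φ = φ) → ∃ j, π.1.IsNearlyEquivalent (πc j).1) →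
    ∃ (s : ℕ) (πc : Fin s → Literature.NumberTheory.Automorphic.CuspidalAutomorphicRepData 4 ℚ hcpt) (rc : Fin s → Literature.NumberTheory.GaloisRepresentations.FramedGaloisRep ℚ (PadicAlgCl p) 4), (∀ j, Summit.Langlands.Langlands.Cruxes.ResiduallyYoshidaLifting.CrossRegularAnnihilatorPrimes.Member σ σ' red ι 𝔫₁ T₁ (πc j) (rc j)) ∧ ∀ (π : Literature.NumberTheory.Automorphic.CuspidalAutomorphicRepData 4 ℚ hcpt) (r : Literature.NumberTheory.GaloisRepresentations.FramedGaloisRep ℚ (PadicAlgCl p) 4), Summit.Langlands.Langlands.Cruxes.ResiduallyYoshidaLifting.CrossRegularAnnihilatorPrimes.Member σ σ' red ι 𝔫₁ T₁ π r → ∃ j, ∀ᶠ v : IsDedekindDomain.HeightOneSpectrum (NumberField.RingOfIntegers ℚ) in Filter.cofinite, ∀ P : Polynomial (PadicAlgCl p), r.HasFrobCharpolyAt v P ↔ (rc j).HasFrobCharpolyAt v P := by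
  intro p _ _ k _ _ _ _ _ red σ σ' hcpt ι 𝔫₁ T₁ _ hfin
  obtain ⟨s, πc, hfin⟩ := hfin
  -- the near-equivalence classes met by a member, and a member in each
  have hJ : ∀ j : {j : Fin s // ∃ π r, Member σ σ' red ι 𝔫₁ T₁ π r ∧ π.1.IsNearlyEquivalent (πc j).1},
      ∃ π r, Member σ σ' red ι 𝔫₁ T₁ π r ∧ π.1.IsNearlyEquivalent (πc j.1).1 := fun j => j.2
  choose πm rm hm hne using hJ
  set e := Fintype.equivFin
    {j : Fin s // ∃ π r, Member σ σ' red ι 𝔫₁ T₁ π r ∧ π.1.IsNearlyEquivalent (πc j).1} with he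
  refine ⟨_, fun i => πm (e.symm i), fun i => rm (e.symm i), fun i => hm _, fun π r hπr => ?_⟩
  obtain ⟨j, hj⟩ := hfin π hπr.2.1 hπr.2.2.1
  refine ⟨e ⟨j, π, r, hπr, hj⟩, ?_⟩
  simp only [Equiv.symm_apply_apply]
  set jJ : {j : Fin s // ∃ π r, Member σ σ' red ι 𝔫₁ T₁ π r ∧ π.1.IsNearlyEquivalent (πc j).1} :=
    ⟨j, π, r, hπr, hj⟩ with hjJ
  have hne' := hne jJ
  have hr := hπr.2.2.2.2.2
  have hr' := (hm jJ).2.2.2.2.2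
  filter_upwards [hj, hne', hr, hr'] with v ⟨b, hb, hcb⟩ ⟨b', hb', hcb'⟩ ⟨a, ha, _, har⟩
    ⟨a', ha', _, har'⟩
  have h1 : a = b := π.1.hasSatakeParamAt_unique_holds ha hb
  have h2 : b' = b := (πc j).1.hasSatakeParamAt_unique_holds hcb' hcb
  have h3 : a' = b' := (πm jJ).1.hasSatakeParamAt_unique_holds ha' hb'
  subst h1 h2 h3
  intro P
  exact ⟨fun h => by rw [← har.unique h]; exact har', fun h => by rw [← har'.unique h]; exact har⟩

end Summit.Langlands.Langlands.Cruxes.ResiduallyYoshidaLifting.CrossRegularAnnihilatorPrimes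

end
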